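import Summits.ValiantsHypothesis.ValiantsHypothesis.Theorems.MonotoneRestorationOrbitRestorationQPPiSigmaClass
import Summits.ValiantsHypothesis.ValiantsHypothesis.Theorems.MonotoneRestorationOrbitRestorationQPExplicitForm
import Literature.Computability.AlgebraicComplexity.DepthThreeChasmCircuits
import Literature.Computability.AlgebraicComplexity.DepthReductionProofs
import HarnessLib

/-!
# Explicit `ΣΠΣ` data of polynomial size lie in the slice `PDClass 1` (crux `OrbitRestorationQP`, stmt-ValiantsHypothesis-18293)

Line `depth_three_rung` (skeleton 5d811172), stub `stub_sigmaPiSigmaValue` (A_∞); namespace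
`Summit.ValiantsHypothesis.ValiantsHypothesis.Theorems.OrbitRestorationQPDepthThreeRung.ExplicitForm`.

`…ExplicitForm.lean` EXTRACTS explicit depth-three data from `PDClass (fun _ => 1) n c` (`exists_explicit_of_pdClassOne`)
and `…PiSigmaClass.lean` puts ONE affine product back (`pdClass_one_affineProd`).  This file closes the loop for SUMS:

* `affVal_coeffs_eq` — a polynomial of total degree `≤ 1` is the affine form of its coefficient data;
* `pdClass_one_of_explicit` — **a sum over a finite index type of size `≤ n^c + c` of scaled products of `≤ n^c + c` affine
  forms lies in `PDClass (fun _ => 1) n c'`** for an explicit `c' = c'(c)` (total degree, Bürgisser complexity via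
  `complexity_finset_sum_le` / `complexity_affineProd_le`, and the GKKS `ΣΠΣ` builder `DepthThreeChasm.exists_sps_circuit`
  for the product-depth-one circuit with polynomially many wires);
* `sigmaPiSigmaValue_iff_explicit'` — hence the `PDClass` conjunct in `sigmaPiSigmaValue_iff_explicit` is REDUNDANT:
  **A_∞ ⟺ every matrix-symmetric family given by explicit polynomial-size `ΣΠΣ` data is quasi-polynomially orbit-restorable.**

Everything is proved; no stub is closed; VP ≠ VNP is not touched. [cite: GuptaKamathKayalSaptharishi2016, §1 eq. (1)]
-/

noncomputable section

open scoped Classical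

-- `Summit.ValiantsHypothesis.ValiantsHypothesis.…` is the tree's single-conjunct layout (Sub = Summit).
set_option linter.dupNamespace false

namespace Summit.ValiantsHypothesis.ValiantsHypothesis.Theorems.OrbitRestorationQPDepthThreeRung

namespace ExplicitForm

open Literature.Computability.AlgebraicComplexity Literature.Computability.AlgebraicComplexity.DepthThreeChasm
open Literature.Computability.AlgebraicComplexity.DepthReduction
open MvPolynomial

variable {n : ℕ}

/-! ### Affine forms from coefficient data -/

/-- A monomial exponent of degree `≤ 1` is `0` or a unit vector. [folklore] -/
theorem finsupp_eq_zero_or_single {τ : Type*} {s : τ →₀ ℕ} (h : s.degree ≤ 1) :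
    s = 0 ∨ ∃ i, s = Finsupp.single i 1 := by
  classical
  by_cases hs : s = 0
  · exact Or.inl hs
  · right
    obtain ⟨i, hi⟩ : ∃ i, s i ≠ 0 := by
      by_contra hall
      push Not at hall
      exact hs (Finsupp.ext hall)
    refine ⟨i, Finsupp.ext fun j => ?_⟩
    have hsum : s.degree = ∑ j ∈ s.support, s j := rfl
    have hi' : i ∈ s.support := Finsupp.mem_support_iff.2 hi
    have hle : s i ≤ s.degree := by
      rw [hsum]
      exact Finset.single_le_sum (fun _ _ => Nat.zero_le _) hi'
    have hsi : s i = 1 := by omega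
    by_cases hji : j = i
    · subst hji
      rw [Finsupp.single_eq_same, hsi]
    · rw [Finsupp.single_apply, if_neg (Ne.symm hji)]
      by_contra hj
      have hj' : j ∈ s.support := Finsupp.mem_support_iff.2 hj
      have h2 : s i + s j ≤ s.degree := by
        rw [hsum, ← Finset.sum_pair (Ne.symm hji)]
        exact Finset.sum_le_sum_of_subset (by
          intro x hx
          rcases Finset.mem_insert.1 hx with rfl | hx
          · exact hi'
          · rw [Finset.mem_singleton.1 hx]; exact hj')
      omega

/-- Affine expansion: a polynomial of total degree `≤ 1` is `C (coeff 0 p) + Σᵢ C (coeff eᵢ p) · Xᵢ`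
(as in `Literature/Barriers/…/BDGIL24AffineInputsVP.lean`, where it is private). [folklore] -/
theorem eq_C_add_sum_of_totalDegree_le_one {τ : Type*} [Fintype τ] {p : MvPolynomial τ ℂ}
    (hp : p.totalDegree ≤ 1) :
    p = C (coeff 0 p) + ∑ i, C (coeff (Finsupp.single i 1) p) * X i := by
  classical
  ext s
  simp only [coeff_add, coeff_C, coeff_sum, coeff_C_mul, coeff_X]
  by_cases hs0 : s = 0
  · subst hs0
    rw [if_pos rfl, Finset.sum_eq_zero (fun i _ => ?_), add_zero]
    rw [if_neg (Finsupp.single_ne_zero.mpr one_ne_zero), mul_zero]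
  rw [if_neg (Ne.symm hs0), zero_add]
  by_cases hs1 : ∃ i, s = Finsupp.single i 1
  · obtain ⟨i, rfl⟩ := hs1
    rw [Finset.sum_eq_single i]
    · rw [if_pos rfl, mul_one]
    · intro j _ hji
      rw [if_neg (fun h => hji (Finsupp.single_left_injective one_ne_zero h)), mul_zero]
    · intro h; exact absurd (Finset.mem_univ i) h
  · have hl : coeff s p = 0 := by
      by_contra h
      have hmem : s ∈ p.support := mem_support_iff.mpr h
      have hdeg : s.degree ≤ 1 := (le_totalDegree hmem).trans hp
      rcases finsupp_eq_zero_or_single hdeg with h | h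
      · exact hs0 h
      · exact hs1 h
    rw [hl, eq_comm]
    refine Finset.sum_eq_zero fun i _ => ?_
    rw [if_neg (fun h => hs1 ⟨i, h.symm⟩), mul_zero]

/-- A polynomial of total degree `≤ 1` is the affine form (`DepthThreeChasm.affVal`) of its coefficient data
`(j ↦ coeff e_j ℓ, coeff 0 ℓ)`. [folklore] -/
theorem affVal_coeffs_eq {τ : Type*} [Fintype τ] (ℓ : MvPolynomial τ ℂ) (hℓ : ℓ.totalDegree ≤ 1) :
    affVal (fun j => coeff (Finsupp.single j 1) ℓ, coeff 0 ℓ) = ℓ := by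
  rw [affVal_apply, add_comm]
  conv_rhs => rw [eq_C_add_sum_of_totalDegree_le_one hℓ]
  congr 1
  exact Finset.sum_congr rfl fun j _ => smul_eq_C_mul _ _

/-- Coefficient data of a multiset of affine forms, as a list. [folklore] -/
theorem map_affVal_coeffs (L : Multiset (MvPolynomial (Fin n × Fin n) ℂ)) (hL : ∀ ℓ ∈ L, ℓ.totalDegree ≤ 1) :
    ((L.toList.map fun ℓ => (fun j => coeff (Finsupp.single j 1) ℓ, coeff 0 ℓ)).map affVal).prod = L.prod := by
  rw [List.map_map]
  have : (L.toList.map (affVal ∘ fun ℓ => (fun j => coeff (Finsupp.single j 1) ℓ, coeff 0 ℓ))) = L.toList := by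
    conv_rhs => rw [← List.map_id L.toList]
    refine List.map_congr_left fun ℓ hℓ => ?_
    simp only [Function.comp_apply, id]
    exact affVal_coeffs_eq ℓ (hL ℓ (Multiset.mem_toList.mp hℓ))
  rw [this, ← Multiset.prod_coe, Multiset.coe_toList]

/-! ### Explicit data lie in the slice -/

/-- **EXPLICIT `ΣΠΣ` DATA OF POLYNOMIAL SIZE LIE IN `PDClass 1`.**  For a finite index type `𝒯` with `#𝒯 ≤ n^c + c`,
scalars `a` and multisets `L τ` of `≤ n^c + c` polynomials of total degree `≤ 1`, the polynomial `Σ_τ C(a τ) · Π (L τ)` lies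
in `PDClass (fun _ => 1) n (2 (2c+8) + 3^(2c+8))`. [cite: GuptaKamathKayalSaptharishi2016, §1 eq. (1)] -/
theorem pdClass_one_of_explicit {c : ℕ} {𝒯 : Type} [Fintype 𝒯] (hT : Fintype.card 𝒯 ≤ n ^ c + c) (a : 𝒯 → ℂ)
    (L : 𝒯 → Multiset (MvPolynomial (Fin n × Fin n) ℂ)) (hdeg : ∀ τ, ∀ ℓ ∈ L τ, ℓ.totalDegree ≤ 1)
    (hcard : ∀ τ, Multiset.card (L τ) ≤ n ^ c + c) :
    PDClass (fun _ => 1) n (2 * (2 * c + 8) + 3 ^ (2 * c + 8)) (∑ τ, C (a τ) * (L τ).prod) := by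
  set B := n + 2 with hB
  have hB2 : 2 ≤ B := by omega
  have hBpos : ∀ e, 1 ≤ B ^ e := fun e => Nat.one_le_pow _ _ (by omega)
  have hp : n ^ c + c ≤ 2 * B ^ c := le_two_mul_pow (le_refl _) (le_refl c)
  have hp1 : n ^ c + c ≤ B ^ (c + 1) := by
    calc n ^ c + c ≤ 2 * B ^ c := hp
      _ ≤ B * B ^ c := Nat.mul_le_mul_right _ hB2
      _ = B ^ (c + 1) := by ring
  have hN : Fintype.card (Fin n × Fin n) = n ^ 2 := by rw [Fintype.card_prod, Fintype.card_fin, sq]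
  have hn2 : 2 * n ^ 2 + 2 ≤ B ^ 3 := by
    rw [hB]; nlinarith [Nat.zero_le n, sq_nonneg (n + 2)]
  -- the master bound: everything below is `≤ B^(2c+8)`
  have hfinal : B ^ (2 * c + 8) ≤ n ^ (2 * (2 * c + 8) + 3 ^ (2 * c + 8)) + (2 * (2 * c + 8) + 3 ^ (2 * c + 8)) := by
    -- `(n+2)^T ≤ n^(2T) + 3^T ≤ n^(2T + 3^T) + (2T + 3^T)` (the landed `vsbr_pow_base_le`, then monotonicity)
    have h := Summit.ValiantsHypothesis.ValiantsHypothesis.Theorems.OrbitRestorationQPDepthThreeRung.vsbr_pow_base_le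
      n (2 * c + 8)
    have h3 : 3 ^ (2 * c + 8) ≤ 2 * (2 * c + 8) + 3 ^ (2 * c + 8) := Nat.le_add_left _ _
    rcases Nat.eq_zero_or_pos n with hn0 | hn
    · subst hn0
      have e1 : (0 : ℕ) ^ (2 * (2 * c + 8)) = 0 := zero_pow (by omega)
      have e2 : (0 : ℕ) ^ (2 * (2 * c + 8) + 3 ^ (2 * c + 8)) = 0 :=
        zero_pow (by positivity : 0 < 2 * (2 * c + 8) + 3 ^ (2 * c + 8)).ne'
      rw [e1] at h
      rw [e2]
      exact h.trans (Nat.add_le_add_left h3 0)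
    · exact h.trans (Nat.add_le_add (Nat.pow_le_pow_right hn (Nat.le_add_right _ _)) h3)
  have hcardT : Fintype.card 𝒯 ≤ B ^ (c + 1) := hT.trans hp1
  have h28 : B ^ (c + 1) ≤ B ^ (2 * c + 8) := Nat.pow_le_pow_right (by omega) (by omega)
  refine ⟨?_, ?_, ?_⟩
  · -- total degree
    refine (totalDegree_finsetSum _ _).trans ((Finset.sup_le fun τ _ => ?_).trans (hp1.trans (h28.trans hfinal)))
    refine (totalDegree_mul _ _).trans ?_
    rw [totalDegree_C, zero_add]
    refine (totalDegree_multiset_prod _).trans ?_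
    have : ((L τ).map totalDegree).sum ≤ ((L τ).map fun _ => 1).sum :=
      Multiset.sum_map_le_sum_map _ _ (hdeg τ)
    rw [Multiset.map_const', Multiset.sum_replicate, smul_eq_mul, mul_one] at this
    exact this.trans (hcard τ)
  · -- complexity
    refine (complexity_finset_sum_le _ _).trans ?_
    have hterm : ∀ τ, complexity (C (a τ) * (L τ).prod) ≤ 2 * B ^ (c + 4) := by
      intro τ
      refine (complexity_mul_le_holds _ _).trans ?_
      rw [complexity_C_holds, zero_add]
      refine (Nat.add_le_add_right (PiSigmaClass.complexity_affineProd_le (L τ) (hdeg τ)) 1).trans ?_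
      rw [hN]
      calc Multiset.card (L τ) * (2 * n ^ 2 + 2) + 1 ≤ B ^ (c + 1) * B ^ 3 + B ^ (c + 4) :=
            Nat.add_le_add (Nat.mul_le_mul ((hcard τ).trans hp1) hn2) (hBpos _)
        _ = 2 * B ^ (c + 4) := by ring
    calc ∑ τ, complexity (C (a τ) * (L τ).prod) + (Finset.univ : Finset 𝒯).card
        ≤ ∑ _τ : 𝒯, 2 * B ^ (c + 4) + Fintype.card 𝒯 :=
          Nat.add_le_add (Finset.sum_le_sum fun τ _ => hterm τ) (by rw [Finset.card_univ])
      _ = Fintype.card 𝒯 * (2 * B ^ (c + 4)) + Fintype.card 𝒯 := by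
          rw [Finset.sum_const, smul_eq_mul, Finset.card_univ]
      _ ≤ B ^ (c + 1) * (2 * B ^ (c + 4)) + B ^ (c + 1) * B ^ (c + 4) :=
          Nat.add_le_add (Nat.mul_le_mul_right _ hcardT)
            (hcardT.trans (Nat.le_mul_of_pos_right _ (hBpos _)))
      _ = 3 * B ^ (2 * c + 5) := by ring
      _ ≤ (B * B * B) * B ^ (2 * c + 5) := Nat.mul_le_mul_right _ (by nlinarith)
      _ = B ^ (2 * c + 8) := by ring
      _ ≤ _ := hfinal
  · -- the product-depth-one circuit (GKKS builder)
    obtain ⟨P, hPev, hPpd, hPE⟩ := exists_sps_circuit (k := ℂ) (σ := Fin n × Fin n) (n ^ c + c) a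
      (fun τ => (L τ).toList.map fun ℓ => (fun j => coeff (Finsupp.single j 1) ℓ, coeff 0 ℓ))
      (fun τ => by rw [List.length_map, Multiset.length_toList]; exact hcard τ)
    refine ⟨P, ?_, hPpd, hPE.trans ?_⟩
    · show P.eval = _
      rw [hPev]
      refine Finset.sum_congr rfl fun τ _ => ?_
      rw [map_affVal_coeffs (L τ) (hdeg τ), smul_eq_C_mul]
    · rw [hN]
      calc Fintype.card 𝒯 * ((n ^ c + c) * (n ^ 2 + 2) + 1)
          ≤ B ^ (c + 1) * (B ^ (c + 1) * B ^ 3 + B ^ (c + 4)) :=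
            Nat.mul_le_mul hcardT (Nat.add_le_add (Nat.mul_le_mul hp1 (by nlinarith)) (hBpos _))
        _ = 2 * B ^ (2 * c + 5) := by ring
        _ ≤ (B * B * B) * B ^ (2 * c + 5) := Nat.mul_le_mul_right _ (by nlinarith)
        _ = B ^ (2 * c + 8) := by ring
        _ ≤ _ := hfinal

/-- **A_∞ ⟺ EXPLICIT A_∞ WITHOUT THE `PDClass` CONJUNCT.**  The registered signature of `stub_sigmaPiSigmaValue` (left,
verbatim) holds iff every matrix-symmetric family given at every level by explicit `ΣΠΣ` data of polynomial size
(`k ≤ n^c + c` scaled products of `≤ n^c + c` polynomials of total degree `≤ 1`) is quasi-polynomially orbit-restorable.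
[folklore] -/
theorem sigmaPiSigmaValue_iff_explicit' :
    (∀ f : (n : ℕ) → MvPolynomial (Fin n × Fin n) ℂ, IsMatrixSymmetric f →
        (∃ c : ℕ, ∀ n : ℕ, PDClass (fun _ => 1) n c (f n)) →
        ∃ c : ℕ, ∀ n : ℕ, QPOrbitRestorable c n (f n)) ↔
    (∀ f : (n : ℕ) → MvPolynomial (Fin n × Fin n) ℂ, IsMatrixSymmetric f →
        (∃ c : ℕ, ∀ n : ℕ, ∃ (k : ℕ) (a : Fin k → ℂ) (L : Fin k → Multiset (MvPolynomial (Fin n × Fin n) ℂ)),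
            (∀ i, ∀ ℓ ∈ L i, ℓ.totalDegree ≤ 1) ∧ k ≤ n ^ c + c ∧
            (∀ i, Multiset.card (L i) ≤ n ^ c + c) ∧ f n = ∑ i, MvPolynomial.C (a i) * (L i).prod) →
        ∃ c : ℕ, ∀ n : ℕ, QPOrbitRestorable c n (f n)) := by
  constructor
  · intro hA f hsym hexp
    obtain ⟨c, hc⟩ := hexp
    refine hA f hsym ⟨2 * (2 * c + 8) + 3 ^ (2 * c + 8), fun n => ?_⟩
    obtain ⟨k, a, L, hdeg, hk, hcard, hfn⟩ := hc n
    rw [hfn]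
    exact pdClass_one_of_explicit (by rw [Fintype.card_fin]; exact hk) a L hdeg hcard
  · intro hE f hsym hPD
    obtain ⟨c, hc⟩ := hPD
    refine hE f hsym ⟨c + 2, fun n => ?_⟩
    obtain ⟨k, a, L, hdeg, hk, hcard, hfn⟩ := exists_explicit_of_pdClassOne (hc n)
    exact ⟨k, a, L, hdeg, hk, hcard, hfn⟩

end ExplicitForm

end Summit.ValiantsHypothesis.ValiantsHypothesis.Theorems.OrbitRestorationQPDepthThreeRung

end
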